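import Mathlib
import Literature.Computability.AlgebraicComplexity.PermanentIrreducible
import Summits.ValiantsHypothesis.ValiantsHypothesis.Theses.DivisionGap

/-!
# Line `typed-vertex-rectangles` — skeleton for crux `DivisionGap.PerDivisionHard`
# (stmt-ValiantsHypothesis-5065, route-ValiantsHypothesis-DivisionGap; crux-plan, round 1)

**Idea (card `typed-vertex-rectangles`, ideator 2; triage r1: pass ×3 "strongest card of the round";
merge ≈ `twisted-diagonal-recursion`, same type-rigidity lever — this skeleton serves both cards).**
Over `ℝ≥0` a monotone circuit for a TORUS-HOMOGENEOUS target `g` (all monomials share their row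
margins `R` and column margins `C`) whose monomials touch every row decomposes as
`g = Σ_{t<s} a_t · b_t`, `s ≤ L(g)`, with every `a_t` itself torus-homogeneous and BALANCED IN ROW
SUPPORT, `n/3 < #rows(a_t) ≤ 2n/3` (Jukna, *Tropical Circuit Complexity*, Lemma 3.1 run with the
subadditive norm "number of rows in the support" instead of degree, plus GATE TYPING: `a·b ≤ g`
coefficientwise with `b ≠ 0` forces fixed margins on `a`) — stub 2.  A PURE monomial of `g` (one
supported inside a perfect matching `{(π j, j)}`) covered by the rectangle `supp a_t + supp b_t` pins
the `a_t`-part to `Σ_i ρ_i e_{i, π⁻¹ i}`, so `π` is admissible for `a_t` only if `ρ ∘ π = γ`: at most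
`#rows! · (n − #rows)! ≤ ⌊2n/3⌋! · ⌈n/3⌉!` permutations per term, independently of all multiplicities
(TYPE RIGIDITY) — stub 3.  Hence (`card_pure_le_of_decomposition`, proved below)
`#Pure(g) ≤ L(g) · ⌊2n/3⌋!⌈n/3⌉! · max_π #Pure_π(g)`; for `g = per_n^M` this is the card's theorem (1)
`L₊(per_n^M) ≥ C(n, ⌈n/3⌉)` for every `M` (the POWERS rung of the crux, previously only `n^{Ω(log n)}` by
Boolean transfer; HY21 Rem. 45–46), and in general it settles the crux for every cheap torus-homogeneous
cofactor RICH in aligned pure monomials.  The cofactor is made torus-homogeneous for free by iterated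
leading forms (stub 1 = the companion card's transfer `C⁺`, Jukna L.1.32 / JS82 Thm 2.4 with weights).
What is left is NAMED: the crux for cheap torus-homogeneous PURE-POOR cofactors (stub 4 — literally the
crux restricted to the complement class, so implied by it; its known sub-cases (monomial content: JSS
contraction; non-omnipresent `h`: the sibling face-descent line) and its open core K2** are listed there.
A circuit-free "typed rank" residual is NOT used: it is false (typed rank of `per·h₁h₂` is `1` for every
balanced torus-homogeneous factor `h₁` of `h`), which is the card's smearing obstruction made sharp.

**Shape.** `PerDivisionHard_of : PerDivisionHard` (no hypotheses) is proved from the four `stub_*` and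
the sorry-free counting lemma `card_pure_le_of_decomposition`; `sorry` occurs only inside `stub_*`.
The card's headline theorem is certified MODULO STUBS 2–3 at the end of the file:
`choose_le_complexity_perPoly_pow : 3 ≤ n → 1 ≤ M → n.choose (n - 2*n/3) ≤ L(per_n^M)` (its only
sorries are `stub_typedDecomposition`, `stub_alignedRigidity`) — the registered stubs compose as claimed.
Stub statements mention only Mathlib, `Literature.Computability.AlgebraicComplexity.{complexity, perPoly}`
and inline notions (torus margins, alignment `e.1 = π e.2` in the `perPoly` convention `X (σ i, i)`), so
each can land as `Theorems/PerDivisionHard<Stub>.lean` with `--supports stmt-ValiantsHypothesis-5065`.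

**Disproof used** (`Cruxes/PerDivisionHard/Disproof.lean`, cdisprove gen 1–2, re-read 2026-08-16):
`perDivisionHard_false_without_nonzero` — honoured: `h ≠ 0` is consumed by stub 1 (`h' ≠ 0`) and is a
hypothesis of stub 4 (without it the pair `(per·0, 0)` costs `0`);
`_false_without_threshold` — honoured: `PerDivisionHard_of` supplies `n₀ := max n₁ 3` (`n₁` from stub 4,
`3 ≤ n` for stub 2); `_false_uniform` — honoured: stub 4 is `∀ c, ∃ n₀(c)`; `not_perDivisionHardOver_of_charTwo`
— honoured: stubs 2–4 are over `ℝ≥0` and stub 2/3's proofs use no-cancellation (`support_mul_eq`,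
`support_add_eq`) exactly where the char-2 analogue fails; tightness `exists_pair_le_factorial` /
`not_perDivisionHardFactorialRate` — respected (the line's bounds are `C(n,⌈n/3⌉) ≤ 2^{0.92 n} < (n+1)·n!`);
floor `perDivisionHardAt_zero/one` — superseded on the power family.  No landed `Negative/` lemma
(LoadBearing, VarsCounting, BooleanShadow, PlainBridge) refutes an instance of any stub; `-- Targets`: none yet.
-/

namespace Summit.ValiantsHypothesis.ValiantsHypothesis.Cruxes.PerDivisionHard.TypedVertexRectangles

open MvPolynomial
open scoped BigOperators Pointwise
open Literature.Computability.AlgebraicComplexity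
open Summit.ValiantsHypothesis.ValiantsHypothesis.Theses.DivisionGap (PerDivisionHard)

set_option linter.dupNamespace false
set_option linter.unusedVariables false

noncomputable section

/-! ## The four stubs -/

/-- **Stub 1 — torus reduction (free iterated leading forms; the companion transfer `C⁺`).**
For every nonzero cofactor `h` there is a nonzero TORUS-HOMOGENEOUS cofactor `h'` (all monomials of
`h'` have the same row margins `r` and the same column margins `cc`) whose pair is at most as
expensive: `L(per·h') ≤ L(per·h)` and `L(h') ≤ L(h)`.
Why true: over `ℝ≥0` the leading form `lf_w f` of `f` for any `ℕ`-weight `w` on the variables is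
computed by the circuit of `f` with the lighter operand of each inhomogeneous sum gate dropped
(Jerrum–Snir 1982 Thm 2.4 = Jukna 2023 Lemma 1.32, there for total degree; the proof is weight-agnostic;
the tree's weighted sum gates `c • u + d • v` and zero/junk operands are harmless), so
`L(lf_w f) ≤ L(f)`; `lf_w (per · h) = per · lf_w h` for a row weight `w = deg_{row i}` or a column weight
(`per` is `w`-homogeneous; `ℝ≥0[x]` has no zero divisors); iterate over the `2n` row and column weights:
`h' :=` the iterated leading form is nonzero and torus-homogeneous, and `per · h'` is the iterated leading
form of `per · h`.  Size M (~300 lines: the leading-form circuit surgery on `ArithCircuit` over `ℝ≥0` via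
`gateValues` induction, cf. `MonotoneGapParseTrees.lean`; then a `2n`-step iteration).
[JerrumSnir1982 Thm 2.4; Jukna2023 L.1.32; cards birkhoff-face-descent A1, pair-descent-jss-endpoint] -/
theorem stub_torusReduction (n : ℕ) (h : MvPolynomial (Fin n × Fin n) NNReal) (hh : h ≠ 0) :
    ∃ h' : MvPolynomial (Fin n × Fin n) NNReal, h' ≠ 0 ∧
      (∃ r cc : Fin n → ℕ, ∀ m ∈ h'.support,
        (∀ i, ∑ j, m (i, j) = r i) ∧ (∀ j, ∑ i, m (i, j) = cc j)) ∧
      complexity (perPoly (Fin n) NNReal * h') ≤ complexity (perPoly (Fin n) NNReal * h) ∧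
      complexity h' ≤ complexity h := by
  sorry

/-- **Stub 2 — the typed, row-support-balanced decomposition (Jukna L.3.1 with the row-support
norm + gate typing).**  For `n ≥ 3`, every TORUS-HOMOGENEOUS `g` (all monomials have row margins `R`
and column margins `C`) all of whose row margins are positive (every monomial touches every row — e.g.
`g = per_n · h`, `g = per_E · h` for a face `E`, `g = per_n^M`) writes `g = Σ_{t < s} a_t · b_t` with
`s ≤ L(g)` and every `a_t` torus-homogeneous (margins `ρ`, `γ`) with `n < 3·#{i | ρ i ≠ 0} ≤ 2n`,
i.e. row support in `(n/3, 2n/3]`.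
Why true (triage r1-2 App. B (i)–(iii), r1-3): take a minimal fan-in-two circuit `P` for `g`
(`ArithCircuit.exists_computes_size_eq_complexity`).  WALK: from the output (row support `n > 2n/3`)
descend, at each gate to an operand whose value has row support `≥` half of the gate's
(`R(c•u+d•v) ⊆ R(u) ∪ R(v)`, `R(u·v) = R(u) ∪ R(v)` for nonzero values over `ℝ≥0`), to the first
operand `v` with `#R(f_v) ≤ 2n/3`; then `#R(f_v) > n/3 ≥ 1`, so `v` is a gate reference (inputs have
`#R ≤ 1`, junk references are `0`), of smaller index.  PEEL: `P.eval = f_v · q + (P.zeroAt v).eval`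
(`exists_eval_eq_zeroAt_add`, any semiring); if `q ≠ 0` then `f_v · q ≤ g` coefficientwise forces every
monomial `m` of `f_v` to have the margins of `g` minus those of a fixed `β ∈ supp q`
(`supp f_v + supp q ⊆ supp g`, no cancellation) — `f_v` is torus-homogeneous with row support
`{ρ ≠ 0} = R(f_v)` — and `(f_v, q)` is a term; in either case continue with `P.zeroAt v`, whose output is
`≤ g` (so again torus-homogeneous with full rows, or `0`) and whose gate values are `≤` those of `P`.
Each round zeroes a gate with nonzero value, so `s ≤ size P = L(g)`; `g = 0` gives `s = 0`.
Size M–L (~500 lines; template: `exists_decomposition` / `exists_prodGate_of_lt_totalDegree` /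
`linked_gateValues_set` in `Literature/Barriers/ValiantsHypothesis/MonotoneGapDecomposition.lean` with
`totalDegree` replaced by the row-support count, `support_mul_eq` / `support_add_eq` of
`MonotoneGapParseTrees.lean`; the tree's `ArithCircuit.exists_balanced_decomposition`
(MonotoneStructure.lean) is the set-multilinear special case with a `4s(n+1)²` term count).
[Jukna2023 L.3.1, L.3.5, Thm 3.6(1); JerrumSnir1982 §3; ChattopadhyayDattaGhosalMukhopadhyay2022 Thm 2.1] -/
theorem stub_typedDecomposition (n : ℕ) (hn : 3 ≤ n) (g : MvPolynomial (Fin n × Fin n) NNReal)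
    (R C : Fin n → ℕ)
    (hg : ∀ m ∈ g.support, (∀ i, ∑ j, m (i, j) = R i) ∧ (∀ j, ∑ i, m (i, j) = C j))
    (hR : ∀ i, R i ≠ 0) :
    ∃ s : ℕ, s ≤ complexity g ∧
      ∃ a b : Fin s → MvPolynomial (Fin n × Fin n) NNReal,
        g = ∑ t, a t * b t ∧
        ∀ t, ∃ ρ γ : Fin n → ℕ,
          (∀ m ∈ (a t).support, (∀ i, ∑ j, m (i, j) = ρ i) ∧ (∀ j, ∑ i, m (i, j) = γ j)) ∧
          n < 3 * (Finset.univ.filter fun i => ρ i ≠ 0).card ∧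
          3 * (Finset.univ.filter fun i => ρ i ≠ 0).card ≤ 2 * n := by
  sorry

/-- **Stub 3 — type rigidity of aligned (pure) monomials: the counting lemma.**  If `a` is
torus-homogeneous with margins `(ρ, γ)` and row support `k := #{i | ρ i ≠ 0}` in the window
`n < 3k ≤ 2n`, then at most `⌊2n/3⌋! · ⌈n/3⌉!` permutations `π` admit a monomial `B ∈ supp a`
supported inside the perfect matching `{(π j, j) | j}` (the `perPoly` convention `X (σ i, i)`).
Why true: such a `B` has in row `π j` only the cell `(π j, j)`, so `B (π j, j) = ρ (π j)` and the column
margins read `γ j = ρ (π j)`: admissible `π` satisfy `ρ ∘ π = γ`, a coset of the stabiliser of `ρ` in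
`S_n` (or nothing), of size `Π_ℓ #{ρ = ℓ}! ≤ (n−k)! · k!`; and `k!(n−k)! ≤ ⌊2n/3⌋!(n−⌊2n/3⌋)!` on the
window because `k ↦ k!(n−k)!` is log-convex and symmetric and `n − ⌊2n/3⌋ ≤ ⌊n/3⌋ + 1 ≤ k ≤ ⌊2n/3⌋`.
Vacuous for `n ≤ 1`; `a = 0` gives the empty set.  Size M (~250 lines; `DomMulAct.stabilizer_card`
(Mathlib: `|{π | f ∘ π = f}| = Π_b (#f⁻¹ b)!`), `Nat.prod_factorial_dvd_factorial_sum`-type bounds,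
`Nat.factorial` monotonicity).  Checked exhaustively for `n ≤ 6`, margins `≤ 3` by triage job j010509(B).
[typed-vertex-rectangles Lever (c); twisted-diagonal-recursion CosetRigidity; Jukna2023 Thm 3.6(1)] -/
theorem stub_alignedRigidity (n : ℕ) (a : MvPolynomial (Fin n × Fin n) NNReal) (ρ γ : Fin n → ℕ)
    (ha : ∀ m ∈ a.support, (∀ i, ∑ j, m (i, j) = ρ i) ∧ (∀ j, ∑ i, m (i, j) = γ j))
    (hlo : n < 3 * (Finset.univ.filter fun i => ρ i ≠ 0).card)
    (hhi : 3 * (Finset.univ.filter fun i => ρ i ≠ 0).card ≤ 2 * n) :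
    (Finset.univ.filter fun π : Equiv.Perm (Fin n) =>
        ∃ B ∈ a.support, ∀ e ∈ B.support, e.1 = π e.2).card ≤
      (2 * n / 3).factorial * (n - 2 * n / 3).factorial := by
  sorry

/-- **Stub 4 — THE RESIDUAL (hardest, open): the crux for cheap, torus-homogeneous, PURE-POOR
cofactors.**  For every `c` and all large `n`: if `h ≠ 0` is torus-homogeneous, CHEAP
(`L(h) ≤ 2^{(log₂ n + c)^c}`) and PURE-POOR — the aligned-pure count of `per·h` is too small for
stubs 2–3 to conclude, `#Pure(per·h) ≤ 2^{(log₂ n + c)^c} · ⌊2n/3⌋!⌈n/3⌉! · #Pure_π(per·h)` for some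
`π`, where `Pure(g)` = monomials of `g` supported inside some perfect matching `{(σ j, j)}` and
`Pure_π(g)` those inside the matching of `π` — then the pair is still expensive:
`2^{(log₂ n + c)^c} < L(per·h) + L(h)`.  This is LITERALLY the crux restricted to the residual class
(so it is implied by the crux and cannot be "more false" than it); the line claims no mechanism for it.
What the class contains and what is already known there: (a) cofactors with non-matching monomial
content `x^u | h` (e.g. `h = Π x_ij`, `#Pure = 0`) — killed by monomial contraction, `L(per·h₀·x^u) ≥
(L(per·h₀)/O(n²))^{1/2}` (JuknaSeiwertSergeev2022 Thm 1 = Jukna2023 L.6.16–Rem 6.19; HY21 Prop 43(3));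
(b) non-omnipresent `h` (block products, cycle-exchange products `h_L`, `U_ℓ^N`, wreath-product and
poly-size permutation sums, bounded-treewidth matching polynomials) — killed by the sibling line
pair-descent-jss-endpoint (face descent to a subdivided `K_{b,b}` face + JSS; TRIAGE r1-2 F4–F5, r1-3
App. C), whose bottom fibres `per_E^{v+1}·x^u` with `v ≥ 1` are in turn discharged by THIS line's stubs
2–3 in face form (stub 2 is stated for any torus-homogeneous full-row `g`, e.g. `g = per_E^{v+1}·x^u`);
(c) the genuinely open core K2** = cheap torus-homogeneous `h` that are pure-poor AND omnipresent
(non-rigid on every placed hard face) — no explicit candidate is known (TRIAGE r1-3 "OPEN").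
Why it might fail: only by failure of the crux itself (a quasi-polynomial monotone pair for some
pure-poor `h`, e.g. an omnipresent exchange-closed cofactor); typed RECTANGLE counting alone cannot
prove it (typed rank of `per·h₁h₂` is `1` whenever `h` has a torus-homogeneous factor `h₁` with balanced
row support — the smearing obstruction of the card, made sharp), so a proof must keep the circuit
(cheapness of BOTH factors `f_v`, `q_v` of every peeled term, which the walk of stub 2 does provide:
`L(q_v) = O(L(g))` by the Baur–Strassen-type bookkeeping of `linked_gateValues_set`).
Consistency with Disproof.lean: uses `h ≠ 0` (`perDivisionHard_false_without_nonzero`), has its own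
`n₀(c)` (`_false_without_threshold`, `_false_uniform`), lives over `ℝ≥0` (`not_perDivisionHardOver_of_charTwo`),
asserts only the quasi-polynomial rate (`not_perDivisionHardFactorialRate`).  Size: open-problem.
[HrubesYehudayoff2021 §6 Problem 2 / Rem 45–46; JuknaSeiwertSergeev2022 Thm 1; cards
pair-descent-jss-endpoint K2, girth-face-rigidity RigidHardFace; typed-vertex-rectangles Barriers] -/
theorem stub_purePoorResidual (c : ℕ) :
    ∃ n₀ : ℕ, ∀ n ≥ n₀, ∀ h : MvPolynomial (Fin n × Fin n) NNReal, h ≠ 0 →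
      ∀ r cc : Fin n → ℕ,
        (∀ m ∈ h.support, (∀ i, ∑ j, m (i, j) = r i) ∧ (∀ j, ∑ i, m (i, j) = cc j)) →
        complexity h ≤ 2 ^ ((Nat.log 2 n + c) ^ c) →
        (∃ π : Equiv.Perm (Fin n),
          ((perPoly (Fin n) NNReal * h).support.filter
              fun m => ∃ σ : Equiv.Perm (Fin n), ∀ e ∈ m.support, e.1 = σ e.2).card ≤
            2 ^ ((Nat.log 2 n + c) ^ c) * ((2 * n / 3).factorial * (n - 2 * n / 3).factorial) *
              ((perPoly (Fin n) NNReal * h).support.filter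
                fun m => ∀ e ∈ m.support, e.1 = π e.2).card) →
        2 ^ ((Nat.log 2 n + c) ^ c) <
          complexity (perPoly (Fin n) NNReal * h) + complexity h := by
  sorry

/-! ## The engine (sorry-free): pure monomials covered by a typed decomposition

`#Pure(g) ≤ s · K · max_π #Pure_π(g)` whenever `g = Σ_{t<s} a_t b_t` and every `a_t` admits at most
`K` permutations (stub 3 supplies `K = ⌊2n/3⌋!⌈n/3⌉!`).  Only `supp (Σ) ⊆ ⋃ supp`,
`supp (a·b) ⊆ supp a + supp b` and `B ≤ B + B'` are used. -/

/-- A monomial of `a · b` supported inside a perfect matching splits as `B + B'` with `B ∈ supp a`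
supported inside the same matching. [folklore] -/
theorem exists_aligned_part {n : ℕ} {a b : MvPolynomial (Fin n × Fin n) NNReal}
    {m : (Fin n × Fin n) →₀ ℕ} (hm : m ∈ (a * b).support) (π : Equiv.Perm (Fin n))
    (hπ : ∀ e ∈ m.support, e.1 = π e.2) :
    ∃ B ∈ a.support, ∀ e ∈ B.support, e.1 = π e.2 := by
  classical
  have hmul := MvPolynomial.support_mul a b hm
  obtain ⟨B, hB, B', hB', hBB'⟩ := Finset.mem_add.mp hmul
  refine ⟨B, hB, fun e he => hπ e ?_⟩
  rw [Finsupp.mem_support_iff] at he ⊢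
  rw [← hBB', Finsupp.add_apply]
  omega

/-- **The typed vertex count.**  If `g = Σ_{t<s} a_t · b_t` and every `a_t` admits at most `K`
permutations `π` (some monomial of `a_t` is supported inside `{(π j, j)}`), then the number of PURE
monomials of `g` (supported inside some perfect matching) is at most `s · K · max_π #Pure_π(g)`.
[typed-vertex-rectangles (1)/(3); Jukna2023 Thm 3.6(1) pattern] -/
theorem card_pure_le_of_decomposition {n s : ℕ} (g : MvPolynomial (Fin n × Fin n) NNReal)
    (a b : Fin s → MvPolynomial (Fin n × Fin n) NNReal) (hg : g = ∑ t, a t * b t) (K : ℕ)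
    (hK : ∀ t, (Finset.univ.filter fun π : Equiv.Perm (Fin n) =>
        ∃ B ∈ (a t).support, ∀ e ∈ B.support, e.1 = π e.2).card ≤ K) :
    ((g.support.filter fun m => ∃ σ : Equiv.Perm (Fin n), ∀ e ∈ m.support, e.1 = σ e.2).card) ≤
      s * K * Finset.univ.sup (fun π : Equiv.Perm (Fin n) =>
        (g.support.filter fun m => ∀ e ∈ m.support, e.1 = π e.2).card) := by
  classical
  -- abbreviations (transparent `let`s)
  let F : Equiv.Perm (Fin n) → ℕ := fun π =>
    (g.support.filter fun m => ∀ e ∈ m.support, e.1 = π e.2).card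
  let M : ℕ := Finset.univ.sup F
  let Pure : Finset ((Fin n × Fin n) →₀ ℕ) :=
    g.support.filter fun m => ∃ σ : Equiv.Perm (Fin n), ∀ e ∈ m.support, e.1 = σ e.2
  have hFM : ∀ π, F π ≤ M := fun π => Finset.le_sup (f := F) (Finset.mem_univ π)
  -- step 1: every pure monomial lies in the support of some term
  have h1 : Pure ⊆ Finset.univ.biUnion fun t => Pure.filter fun m => m ∈ (a t * b t).support := by
    intro m hm
    have hmg : m ∈ g.support := (Finset.mem_filter.mp hm).1
    rw [hg] at hmg
    obtain ⟨t, -, ht⟩ := Finset.mem_biUnion.mp (MvPolynomial.support_sum hmg)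
    exact Finset.mem_biUnion.mpr ⟨t, Finset.mem_univ t, Finset.mem_filter.mpr ⟨hm, ht⟩⟩
  -- step 2: one term covers pure monomials aligned with at most `K` permutations
  have h2 : ∀ t, (Pure.filter fun m => m ∈ (a t * b t).support).card ≤ K * M := by
    intro t
    let Adm : Finset (Equiv.Perm (Fin n)) :=
      Finset.univ.filter fun π : Equiv.Perm (Fin n) =>
        ∃ B ∈ (a t).support, ∀ e ∈ B.support, e.1 = π e.2
    have hsub : (Pure.filter fun m => m ∈ (a t * b t).support) ⊆
        Adm.biUnion fun π => g.support.filter fun m => ∀ e ∈ m.support, e.1 = π e.2 := by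
      intro m hm
      obtain ⟨hmP, hmab⟩ := Finset.mem_filter.mp hm
      obtain ⟨hmg, σ, hσ⟩ := Finset.mem_filter.mp hmP
      obtain ⟨B, hB, hBσ⟩ := exists_aligned_part hmab σ hσ
      exact Finset.mem_biUnion.mpr ⟨σ, Finset.mem_filter.mpr ⟨Finset.mem_univ σ, B, hB, hBσ⟩,
        Finset.mem_filter.mpr ⟨hmg, hσ⟩⟩
    calc (Pure.filter fun m => m ∈ (a t * b t).support).card
        ≤ (Adm.biUnion fun π => g.support.filter fun m => ∀ e ∈ m.support, e.1 = π e.2).card :=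
          Finset.card_le_card hsub
      _ ≤ ∑ π ∈ Adm, F π := Finset.card_biUnion_le
      _ ≤ ∑ π ∈ Adm, M := Finset.sum_le_sum fun π _ => hFM π
      _ = Adm.card * M := by rw [Finset.sum_const, smul_eq_mul]
      _ ≤ K * M := Nat.mul_le_mul_right M (hK t)
  -- step 3: sum over the `s` terms
  calc Pure.card
      ≤ (Finset.univ.biUnion fun t => Pure.filter fun m => m ∈ (a t * b t).support).card :=
        Finset.card_le_card h1
    _ ≤ ∑ t, (Pure.filter fun m => m ∈ (a t * b t).support).card := Finset.card_biUnion_le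
    _ ≤ ∑ _t : Fin s, K * M := Finset.sum_le_sum fun t _ => h2 t
    _ = s * (K * M) := by rw [Finset.sum_const, Finset.card_univ, Fintype.card_fin, smul_eq_mul]
    _ = s * K * M := (Nat.mul_assoc s K M).symm

/-! ## Glue (sorry-free): the crux from the four stubs -/

/-- `per_n · h` is torus-homogeneous with margins `(r + 1, cc + 1)` when `h` has margins `(r, cc)`:
every monomial of `per · h` is `μ_σ + A` with `μ_σ` a permutation monomial (one cell per row and
column) and `A ∈ supp h` (`support_mul`, `exists_permMonomial_eq_of_coeff_perPoly_ne_zero`,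
`rowCount_permMonomial`). [folklore] -/
theorem margins_perPoly_mul {n : ℕ} {h : MvPolynomial (Fin n × Fin n) NNReal} {r cc : Fin n → ℕ}
    (hh : ∀ m ∈ h.support, (∀ i, ∑ j, m (i, j) = r i) ∧ (∀ j, ∑ i, m (i, j) = cc j)) :
    ∀ m ∈ (perPoly (Fin n) NNReal * h).support,
      (∀ i, ∑ j, m (i, j) = r i + 1) ∧ (∀ j, ∑ i, m (i, j) = cc j + 1) := by
  classical
  intro m hm
  obtain ⟨u, hu, A, hA, rfl⟩ := Finset.mem_add.mp (MvPolynomial.support_mul _ _ hm)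
  obtain ⟨σ, rfl⟩ :=
    exists_permMonomial_eq_of_coeff_perPoly_ne_zero NNReal (MvPolynomial.mem_support_iff.mp hu)
  obtain ⟨hr, hc⟩ := hh A hA
  refine ⟨fun i => ?_, fun j => ?_⟩
  · have h1 : ∑ j, permMonomial σ (i, j) = 1 := rowCount_permMonomial σ i
    have h2 := hr i
    simp only [Finsupp.coe_add, Pi.add_apply, Finset.sum_add_distrib, h1, h2]
    omega
  · have h1 : ∑ i, permMonomial σ (i, j) = 1 := colCount_permMonomial σ j
    have h2 := hc j
    simp only [Finsupp.coe_add, Pi.add_apply, Finset.sum_add_distrib, h1, h2]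
    omega

/-- **`PerDivisionHard` from the line.**  Given `c`, take `n₀ := max n₁ 3` with `n₁` from stub 4.
For `n ≥ n₀` and `h ≠ 0`: stub 1 replaces `h` by a torus-homogeneous `h' ≠ 0` with a cheaper pair, so it
suffices to bound the pair of `h'`.  If `h'` is expensive the pair is.  Otherwise stub 2 decomposes the
torus-homogeneous, full-row `per·h' = Σ_{t<s} a_t b_t` with `s ≤ L(per·h')`, typed; if `h'` is PURE-RICH,
stub 3 and the count give `budget·K·P < #Pure ≤ s·K·P`, so `budget < s ≤ L(per·h')`; if `h'` is
PURE-POOR, stub 4 is exactly the claim. -/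
theorem PerDivisionHard_of : PerDivisionHard := by
  intro c
  obtain ⟨n₁, hn₁⟩ := stub_purePoorResidual c
  refine ⟨max n₁ 3, ?_⟩
  intro n hn h hh
  have hn3 : 3 ≤ n := le_trans (le_max_right n₁ 3) hn
  have hn1 : n ≥ n₁ := le_trans (le_max_left n₁ 3) hn
  obtain ⟨h', hh', ⟨r, cc, hth⟩, hle1, hle2⟩ := stub_torusReduction n h hh
  suffices key : 2 ^ ((Nat.log 2 n + c) ^ c) <
      complexity (perPoly (Fin n) NNReal * h') + complexity h' by omega
  by_cases hcheap : complexity h' ≤ 2 ^ ((Nat.log 2 n + c) ^ c)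
  swap
  · omega
  by_cases hrich : ∀ π : Equiv.Perm (Fin n),
      2 ^ ((Nat.log 2 n + c) ^ c) * ((2 * n / 3).factorial * (n - 2 * n / 3).factorial) *
          ((perPoly (Fin n) NNReal * h').support.filter
            fun m => ∀ e ∈ m.support, e.1 = π e.2).card <
        ((perPoly (Fin n) NNReal * h').support.filter
          fun m => ∃ σ : Equiv.Perm (Fin n), ∀ e ∈ m.support, e.1 = σ e.2).card
  · -- pure-rich: typed decomposition (stub 2) + type rigidity (stub 3) + the count
    obtain ⟨s, hs, a, b, hsum, htyped⟩ :=
      stub_typedDecomposition n hn3 (perPoly (Fin n) NNReal * h') (fun i => r i + 1)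
        (fun j => cc j + 1) (margins_perPoly_mul hth) (fun i => Nat.succ_ne_zero _)
    have hK : ∀ t, (Finset.univ.filter fun π : Equiv.Perm (Fin n) =>
        ∃ B ∈ (a t).support, ∀ e ∈ B.support, e.1 = π e.2).card ≤
          (2 * n / 3).factorial * (n - 2 * n / 3).factorial := by
      intro t
      obtain ⟨ρ, γ, h1, h2, h3⟩ := htyped t
      exact stub_alignedRigidity n (a t) ρ γ h1 h2 h3
    have heng := card_pure_le_of_decomposition (perPoly (Fin n) NNReal * h') a b hsum _ hK
    obtain ⟨π, -, hπ⟩ :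
        ∃ π ∈ (Finset.univ : Finset (Equiv.Perm (Fin n))),
          (Finset.univ.sup fun π : Equiv.Perm (Fin n) =>
            ((perPoly (Fin n) NNReal * h').support.filter
              fun m => ∀ e ∈ m.support, e.1 = π e.2).card) =
          ((perPoly (Fin n) NNReal * h').support.filter
              fun m => ∀ e ∈ m.support, e.1 = π e.2).card :=
      Finset.exists_mem_eq_sup _ Finset.univ_nonempty _
    rw [hπ] at heng
    have hbs : 2 ^ ((Nat.log 2 n + c) ^ c) < s :=
      Nat.lt_of_mul_lt_mul_right (Nat.lt_of_mul_lt_mul_right (lt_of_lt_of_le (hrich π) heng))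
    omega
  · -- pure-poor: the residual (stub 4) is exactly the claim
    push Not at hrich
    obtain ⟨π, hπ⟩ := hrich
    exact hn₁ n hn1 h' hh' r cc hth hcheap ⟨π, hπ⟩

/-! ## Corollary modulo stubs 2–3: the POWERS rung `C(n, ⌈n/3⌉) ≤ L₊(per_n^M)` for every `M ≥ 1`

The card's theorem (1) (`choose_le_complexity_perPoly_pow`; triage r1-1/2/3 "checks out"): kernel-checked
here from `stub_typedDecomposition` + `stub_alignedRigidity` + the sorry-free count, as a certificate
that the registered stubs compose to the headline bound (`n - 2 * n / 3 = ⌈n/3⌉ = (n + 2) / 3`).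
In print only `n^{Ω(log n)}` (Boolean transfer, Razborov 1985; HY21 Rem. 45–46) was available for
powers of the permanent. -/

/-- Over `ℝ≥0` the sum of a monomial of `f` and a monomial of `g` is a monomial of `f * g`
(no cancellation; copy of `add_mem_support_mul` of `MonotoneStructure.lean`). [folklore] -/
theorem add_mem_support_mul' {n : ℕ} {f g : MvPolynomial (Fin n × Fin n) NNReal}
    {m m' : (Fin n × Fin n) →₀ ℕ} (hm : m ∈ f.support) (hm' : m' ∈ g.support) :
    m + m' ∈ (f * g).support := by
  classical
  rw [mem_support_iff] at hm hm' ⊢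
  rw [coeff_mul]
  intro h
  have h0 := (Finset.sum_eq_zero_iff.1 h) (m, m') (Finset.HasAntidiagonal.mem_antidiagonal.2 rfl)
  rcases mul_eq_zero.1 h0 with h1 | h1
  · exact hm h1
  · exact hm' h1

/-- The margins of `per_n^k` are `(k, k)`. [folklore] -/
theorem margins_perPoly_pow {n : ℕ} (k : ℕ) :
    ∀ m ∈ ((perPoly (Fin n) NNReal) ^ k).support,
      (∀ i, ∑ j, m (i, j) = k) ∧ (∀ j, ∑ i, m (i, j) = k) := by
  classical
  induction k with
  | zero =>
    intro m hm
    rw [pow_zero, MvPolynomial.support_one] at hm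
    rw [Finset.mem_singleton.mp hm]
    simp
  | succ k ih =>
    intro m hm
    rw [pow_succ'] at hm
    have h := margins_perPoly_mul (r := fun _ => k) (cc := fun _ => k) ih m hm
    exact ⟨fun i => h.1 i, fun j => h.2 j⟩

/-- The vertex monomials `k • μ_σ` lie in the support of `per_n^k`. [folklore] -/
theorem smul_permMonomial_mem_support_pow {n : ℕ} (k : ℕ) (σ : Equiv.Perm (Fin n)) :
    k • permMonomial σ ∈ ((perPoly (Fin n) NNReal) ^ k).support := by
  classical
  induction k with
  | zero =>
    rw [pow_zero, MvPolynomial.support_one, zero_smul]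
    exact Finset.mem_singleton_self 0
  | succ k ih =>
    rw [pow_succ', succ_nsmul']
    refine add_mem_support_mul' ?_ ih
    rw [mem_support_iff, coeff_permMonomial_perPoly]
    exact one_ne_zero

/-- A monomial with all column sums `M` supported inside the matching of `π` is `M • μ_π`, read
cellwise. [folklore] -/
theorem apply_eq_of_aligned {n M : ℕ} {π : Equiv.Perm (Fin n)} {m : (Fin n × Fin n) →₀ ℕ}
    (hcol : ∀ j, ∑ i, m (i, j) = M) (hal : ∀ e ∈ m.support, e.1 = π e.2) (i j : Fin n) :
    m (i, j) = if i = π j then M else 0 := by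
  classical
  have hzero : ∀ i', i' ≠ π j → m (i', j) = 0 := by
    intro i' hi'
    by_contra hne
    exact hi' (hal (i', j) (Finsupp.mem_support_iff.mpr hne))
  split_ifs with h
  · have hj := hcol j
    rw [Finset.sum_eq_single (π j)] at hj
    · rw [h]; exact hj
    · intro i' _ hi'; exact hzero i' hi'
    · intro habs; exact absurd (Finset.mem_univ _) habs
  · exact hzero i h

/-- **The powers rung, modulo stubs 2–3.**  `C(n, ⌈n/3⌉) ≤ L₊(per_n^M)` for all `n ≥ 3`, `M ≥ 1`
(the only `sorry`s in its closure are `stub_typedDecomposition` and `stub_alignedRigidity`). -/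
theorem choose_le_complexity_perPoly_pow (n M : ℕ) (hn : 3 ≤ n) (hM : 1 ≤ M) :
    Nat.choose n (n - 2 * n / 3) ≤ complexity ((perPoly (Fin n) NNReal) ^ M) := by
  classical
  -- typed decomposition of the torus-homogeneous, full-row target `per^M`
  obtain ⟨s, hs, a, b, hsum, htyped⟩ :=
    stub_typedDecomposition n hn ((perPoly (Fin n) NNReal) ^ M) (fun _ => M) (fun _ => M)
      (margins_perPoly_pow M) (fun _ => by omega)
  have hK : ∀ t, (Finset.univ.filter fun π : Equiv.Perm (Fin n) =>
      ∃ B ∈ (a t).support, ∀ e ∈ B.support, e.1 = π e.2).card ≤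
        (2 * n / 3).factorial * (n - 2 * n / 3).factorial := by
    intro t
    obtain ⟨ρ, γ, h1, h2, h3⟩ := htyped t
    exact stub_alignedRigidity n (a t) ρ γ h1 h2 h3
  have heng := card_pure_le_of_decomposition ((perPoly (Fin n) NNReal) ^ M) a b hsum _ hK
  -- at most one monomial of `per^M` inside each perfect matching
  have hsup : (Finset.univ.sup fun π : Equiv.Perm (Fin n) =>
      (((perPoly (Fin n) NNReal) ^ M).support.filter
        fun m => ∀ e ∈ m.support, e.1 = π e.2).card) ≤ 1 := by
    refine Finset.sup_le fun π _ => Finset.card_le_one.mpr ?_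
    intro m hm m' hm'
    obtain ⟨hm, hal⟩ := Finset.mem_filter.mp hm
    obtain ⟨hm', hal'⟩ := Finset.mem_filter.mp hm'
    have hc := (margins_perPoly_pow M m hm).2
    have hc' := (margins_perPoly_pow M m' hm').2
    ext ⟨i, j⟩
    rw [apply_eq_of_aligned hc hal i j, apply_eq_of_aligned hc' hal' i j]
  -- all `n!` vertex monomials are pure and distinct
  have hpure : n.factorial ≤ (((perPoly (Fin n) NNReal) ^ M).support.filter
      fun m => ∃ σ : Equiv.Perm (Fin n), ∀ e ∈ m.support, e.1 = σ e.2).card := by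
    have hinj : Function.Injective fun σ : Equiv.Perm (Fin n) => M • permMonomial σ := by
      intro σ τ hστ
      apply permMonomial_injective
      ext e
      have he := DFunLike.congr_fun hστ e
      simp only [Finsupp.smul_apply, smul_eq_mul] at he
      exact Nat.eq_of_mul_eq_mul_left (by omega) he
    have hsub : (Finset.univ.image fun σ : Equiv.Perm (Fin n) => M • permMonomial σ) ⊆
        (((perPoly (Fin n) NNReal) ^ M).support.filter
          fun m => ∃ σ : Equiv.Perm (Fin n), ∀ e ∈ m.support, e.1 = σ e.2) := by
      intro m hm
      obtain ⟨σ, -, rfl⟩ := Finset.mem_image.mp hm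
      refine Finset.mem_filter.mpr ⟨smul_permMonomial_mem_support_pow M σ, σ, ?_⟩
      intro e he
      rw [Finsupp.mem_support_iff, Finsupp.smul_apply, smul_eq_mul] at he
      have hμ : permMonomial σ (e.1, e.2) ≠ 0 := fun h0 => he (by rw [show e = (e.1, e.2) from rfl, h0, mul_zero])
      rw [permMonomial_apply] at hμ
      by_contra hne
      exact hμ (if_neg fun h' => hne h'.symm)
    calc n.factorial = (Finset.univ : Finset (Equiv.Perm (Fin n))).card := by
          rw [Finset.card_univ, Fintype.card_perm, Fintype.card_fin]
      _ = (Finset.univ.image fun σ : Equiv.Perm (Fin n) => M • permMonomial σ).card :=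
          (Finset.card_image_of_injective _ hinj).symm
      _ ≤ _ := Finset.card_le_card hsub
  -- combine: n! ≤ s·K·1 ≤ L·K, and C(n, n-⌊2n/3⌋)·K = n!
  have hKpos : 0 < (2 * n / 3).factorial * (n - 2 * n / 3).factorial :=
    Nat.mul_pos (Nat.factorial_pos _) (Nat.factorial_pos _)
  have h1 : n.factorial ≤ complexity ((perPoly (Fin n) NNReal) ^ M) *
      ((2 * n / 3).factorial * (n - 2 * n / 3).factorial) := by
    calc n.factorial ≤ _ := hpure
      _ ≤ _ := heng
      _ ≤ s * ((2 * n / 3).factorial * (n - 2 * n / 3).factorial) * 1 :=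
          Nat.mul_le_mul_left _ hsup
      _ ≤ complexity ((perPoly (Fin n) NNReal) ^ M) *
          ((2 * n / 3).factorial * (n - 2 * n / 3).factorial) := by
          rw [Nat.mul_one]; exact Nat.mul_le_mul_right _ hs
  have h2 : Nat.choose n (n - 2 * n / 3) * ((2 * n / 3).factorial * (n - 2 * n / 3).factorial) =
      n.factorial := by
    have hle : 2 * n / 3 ≤ n := by omega
    have h := Nat.choose_mul_factorial_mul_factorial (Nat.sub_le n (2 * n / 3))
    rw [Nat.sub_sub_self hle] at h
    calc Nat.choose n (n - 2 * n / 3) * ((2 * n / 3).factorial * (n - 2 * n / 3).factorial)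
        = Nat.choose n (n - 2 * n / 3) * (n - 2 * n / 3).factorial * (2 * n / 3).factorial := by ring
      _ = n.factorial := h
  exact Nat.le_of_mul_le_mul_right (h2 ▸ h1) hKpos

end

end Summit.ValiantsHypothesis.ValiantsHypothesis.Cruxes.PerDivisionHard.TypedVertexRectangles
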